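import Mathlib.FieldTheory.Galois.Infinite
import Mathlib.FieldTheory.AbsoluteGaloisGroup
import Literature.AlgebraicGeometry.Frobenioids.QuasiTemperoidInductionFunctor
import Literature.AlgebraicGeometry.Frobenioids.FiniteEtaleBase
import HarnessLib

/-!
# Frobenioids II, Example 1.3 (iii) / Example 1.1 (ii): the Galois-correspondence functor
# `B^temp(G_F)⁰ → D₀` from connected continuous `G_F`-sets to connected finite étale coverings of `Spec F`

Mochizuki, *The geometry of Frobenioids II*, Kyushu J. Math. **62** (2008) 401–460, §1, Example 1.3 (iii),
author's text pp. 11–12 [cite: MochizukiFrdII2008, Ex 1.3 (iii) pp.11-12]: an open homomorphism `Π → Q`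
(`G_F ↠ Q`) "determines a functor `B^temp(Π, Π°)⁰ ↪ B^temp(Π)⁰ → B^temp(Q)⁰ ↪ B^temp(G_F)⁰` … In
particular, when `F = ℚ_p`, if we set `D := B^temp(Π, Π°)⁰`, then we obtain a functor `D → D₀ = B^temp(G_{ℚ_p})⁰`
**[cf. Example 1.1, (ii)]** which satisfies the hypotheses of Theorem 1.2, (i)"; and Example 1.1 (i), p. 7
[cite: MochizukiFrdII2008, Ex 1.1 (i) p.7]: "`D₀` [is] the full subcategory of connected objects of the
Galois category of finite étale coverings of `Spec(ℚ_p)`".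

THE JUNCTION. The tree types the base `D₀` of the `p`-adic Frobenioid of Example 1.1 as a category of
FIELDS — `FinEtale F` (`FiniteEtaleBase.lean`: objects the finite separable extensions `K/F`, a morphism
`Spec K → Spec L` an `F`-algebra map `L → K`) resp. `PadicFrd.PadicFld p` — and every consumer of
Theorem 1.2 (`PadicFrd.Datum.base : D ⥤ PadicFld p`) binds the base functor; Example 1.3 (iii) lands in
the category of `G_F`-SETS `B^temp(G_F)⁰` (`QuasiTemperoid.galoisBaseFunctor`, `QuasiTemperoidGaloisBase.lean`).
The printed "[cf. Example 1.1, (ii)]" is the classical identification of the two (Grothendieck's form of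
Galois theory: a transitive continuous `G_F`-set is `G_F/G_K = Hom_F(K, F̄)` for the finite separable
extension `K = F̄^{Stab(x)}`). This file CONSTRUCTS that identification as a functor, for a perfect field `F`
(so that `F̄/F` is Galois; covers `ℚ_p`, `ℝ`, number fields):

* `QuasiTemperoid.galoisFields F : ConnectedPart (BTemp (Field.absoluteGaloisGroup F)) ⥤ FinEtale F` (the group
  written `GalFbar F := F̄ ≃ₐ[F] F̄`, which IS `Field.absoluteGaloisGroup F` by `rfl`) —
  on objects `X ↦ Spec F̄^{Stab(x_X)}` (the fixed field of the — open — stabiliser of a chosen point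
  `x_X`; finite over `F` by Krull's correspondence, Mathlib `InfiniteGalois.isOpen_iff_finite`), on
  morphisms `f : X → Y ↦ (F̄^{Stab(x_Y)} → F̄^{Stab(x_X)}, a ↦ g·a)` for ANY `g ∈ G_F` with `g·x_Y = f(x_X)`
  (independent of `g`: `galoisFields_map_apply`);
* `galoisFields_faithful` — it is faithful (two `G_F`-maps out of a transitive `G_F`-set inducing the same
  field embedding agree: `Stab(x_Y)` is closed, so it is recovered as the fixing group of its fixed field,
  `InfiniteGalois.fixingSubgroup_fixedField`).

With it, the printed composite of Example 1.3 (iii) followed by `galoisFields ℚ_p` is a base functor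
`B^temp(Π, Π°)⁰ → D₀` of the shape Theorem 1.2 consumes (connectedness / total epimorphicity of the source
are `QuasiTemperoid.connectedPartIsConnected_holds` / `connectedPartIsTotallyEpimorphic_holds`); the lift
to VALUED fields (`PadicFld p`, the unique extension of the `p`-adic valuation inside `ℚ̄_p`) is a separate
step not taken here. Fullness and essential surjectivity (the rest of the classical equivalence
`B(G_F)⁰ ≃ D₀`) are not needed for the junction and are not proved here. Elementary Galois theory over
Mathlib; no statement of the paper is strengthened; nothing here bears on [IUTchIII].
-/

namespace Literature.AlgebraicGeometry.Frobenioids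

namespace QuasiTemperoid

open CategoryTheory Topology
open Literature.AnabelianGeometry.SemiGraphs

universe u

section General

variable {G : Type u} [Group G] [TopologicalSpace G]

/-- A chosen point of a connected object of `B^temp(Π)` (connected objects are single — nonempty — orbits,
FrdII Ex. 1.3 (i), p. 11). [cite: MochizukiFrdII2008, Ex 1.3 (i) p.11] -/
noncomputable def basePt (X : ConnectedPart (BTemp G)) : X.obj.obj.V :=
  (BTempConnected.nonempty_of_isConnectedObj X.obj X.property).some

/-- The underlying map of points of a morphism of `B^temp(Π)⁰`. [cite: MochizukiFrdII2008, Ex 1.3 (ii) p.11] -/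
abbrev ptMap {X Y : ConnectedPart (BTemp G)} (f : X ⟶ Y) (x : X.obj.obj.V) : Y.obj.obj.V :=
  f.hom.hom.hom x

/-- Equivariance of the underlying map. [cite: MochizukiFrdII2008, Ex 1.3 (ii) p.11] -/
theorem ptMap_ρ {X Y : ConnectedPart (BTemp G)} (f : X ⟶ Y) (g : G) (x : X.obj.obj.V) :
    ptMap f (X.obj.obj.ρ g x) = Y.obj.obj.ρ g (ptMap f x) :=
  BTempConnected.hom_ρ f.hom g x

/-- The underlying map of the identity. [cite: MochizukiFrdII2008, Ex 1.3 (ii) p.11] -/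
@[simp] theorem ptMap_id (X : ConnectedPart (BTemp G)) (x : X.obj.obj.V) : ptMap (𝟙 X) x = x := rfl

/-- The underlying map of a composite. [cite: MochizukiFrdII2008, Ex 1.3 (ii) p.11] -/
@[simp] theorem ptMap_comp {X Y Z : ConnectedPart (BTemp G)} (f : X ⟶ Y) (h : Y ⟶ Z) (x : X.obj.obj.V) :
    ptMap (f ≫ h) x = ptMap h (ptMap f x) := rfl

/-- Some group element carries the base point of the (transitive) target onto the image of the base
point of the source. [cite: MochizukiFrdII2008, Ex 1.3 (ii) p.11] -/
theorem exists_carrier {X Y : ConnectedPart (BTemp G)} (f : X ⟶ Y) :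
    ∃ g : G, Y.obj.obj.ρ g (basePt Y) = ptMap f (basePt X) :=
  BTempConnected.exists_ρ_eq_of_isConnectedObj Y.obj Y.property _ _

/-- A chosen `g_f ∈ Π` with `g_f · x_Y = f(x_X)`. [cite: MochizukiFrdII2008, Ex 1.3 (ii) p.11] -/
noncomputable def carrier {X Y : ConnectedPart (BTemp G)} (f : X ⟶ Y) : G :=
  (exists_carrier f).choose

/-- Its defining property. [cite: MochizukiFrdII2008, Ex 1.3 (ii) p.11] -/
theorem carrier_spec {X Y : ConnectedPart (BTemp G)} (f : X ⟶ Y) :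
    Y.obj.obj.ρ (carrier f) (basePt Y) = ptMap f (basePt X) :=
  (exists_carrier f).choose_spec

/-- Transport of stabilisers along a morphism: if `g · y = f(x)`, then `g⁻¹ · Stab(x) · g ⊆ Stab(y)`.
[cite: MochizukiFrdII2008, Ex 1.3 (ii) p.11] -/
theorem conj_mem_stabilizer_of_ρ_eq {X Y : ConnectedPart (BTemp G)} (f : X ⟶ Y) {x : X.obj.obj.V}
    {y : Y.obj.obj.V} {g : G} (hg : Y.obj.obj.ρ g y = ptMap f x) {σ : G}
    (hσ : σ ∈ stabilizerSubgroup X.obj x) : g⁻¹ * σ * g ∈ stabilizerSubgroup Y.obj y := by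
  rw [mem_stabilizerSubgroup_iff] at hσ ⊢
  rw [BTempConnected.ρ_mul_apply, BTempConnected.ρ_mul_apply, hg, ← ptMap_ρ, hσ, ← hg,
    BTempConnected.ρ_inv_apply]

/-- Two elements carrying `y` to the same point differ by the stabiliser of `y`.
[cite: MochizukiFrdII2008, Ex 1.3 (ii) p.11] -/
theorem inv_mul_mem_stabilizer_of_ρ_eq {Y : ConnectedPart (BTemp G)} {y : Y.obj.obj.V} {g g' : G}
    (h : Y.obj.obj.ρ g y = Y.obj.obj.ρ g' y) : g⁻¹ * g' ∈ stabilizerSubgroup Y.obj y := by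
  rw [mem_stabilizerSubgroup_iff, BTempConnected.ρ_mul_apply, ← h, BTempConnected.ρ_inv_apply]

end General

/-! ### The absolute Galois group and the fixed fields of stabilisers -/

section Galois

variable (F : Type u) [Field F]

/-- `F̄`, an algebraic closure, on which `G_F = Gal(F̄/F)` (`GalFbar F` = `Field.absoluteGaloisGroup F`) acts.
[cite: MochizukiFrdII2008, Ex 1.3 (iii) pp.11-12] -/
abbrev Fbar : Type u := AlgebraicClosure F

/-- `G_F = Gal(F̄/F)` as the group of `F`-algebra automorphisms of `F̄` — by DEFINITION Mathlib's
`Field.absoluteGaloisGroup F` (`galFbar_eq_absoluteGaloisGroup`), written through its reducible form so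
that its elements apply to elements of `F̄`. [cite: MochizukiFrdII2008, Ex 1.3 (iii) pp.11-12] -/
abbrev GalFbar : Type u := Fbar F ≃ₐ[F] Fbar F

/-- `GalFbar F` IS `Field.absoluteGaloisGroup F` (definitionally), with the same group structure and
Krull topology; hence `BTemp (GalFbar F)` is `BTemp (Field.absoluteGaloisGroup F)`, the target of
`QuasiTemperoid.galoisBaseFunctor`. [cite: MochizukiFrdII2008, Ex 1.3 (iii) pp.11-12] -/
theorem galFbar_eq_absoluteGaloisGroup : GalFbar F = Field.absoluteGaloisGroup F := rfl

/-- … so the categories of tempered sets agree on the nose. [cite: MochizukiFrdII2008, Ex 1.3 (iii) pp.11-12] -/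
theorem bTemp_galFbar_eq : BTemp (GalFbar F) = BTemp (Field.absoluteGaloisGroup F) := rfl

variable {F}

/-- In `Gal(F̄/F)`: an element of the fixed field of `H` is fixed by `g'` as by `g` whenever `g⁻¹ g' ∈ H`.
[cite: MochizukiFrdII2008, Ex 1.3 (iii) pp.11-12] -/
theorem apply_eq_apply_of_inv_mul_mem {H : Subgroup (GalFbar F)}
    {g g' : GalFbar F} (h : g⁻¹ * g' ∈ H) {a : Fbar F}
    (ha : a ∈ IntermediateField.fixedField H) : g' a = g a := by
  rw [IntermediateField.mem_fixedField_iff] at ha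
  have h1 : (g⁻¹ * g') a = a := ha _ h
  rw [AlgEquiv.mul_apply, AlgEquiv.aut_inv, AlgEquiv.symm_apply_eq] at h1
  exact h1

/-- In `Gal(F̄/F)`: if `g⁻¹ · Stab · g ⊆ H` elementwise for the subgroup `S`, then `g` maps the fixed field
of `H` into the fixed field of `S`. [cite: MochizukiFrdII2008, Ex 1.3 (iii) pp.11-12] -/
theorem apply_mem_fixedField_of_conj_mem {S H : Subgroup (GalFbar F)}
    {g : GalFbar F} (h : ∀ σ ∈ S, g⁻¹ * σ * g ∈ H) {a : Fbar F}
    (ha : a ∈ IntermediateField.fixedField H) : g a ∈ IntermediateField.fixedField S := by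
  rw [IntermediateField.mem_fixedField_iff] at ha ⊢
  intro σ hσ
  have h1 : (g⁻¹ * σ * g) a = a := ha _ (h σ hσ)
  rw [AlgEquiv.mul_apply, AlgEquiv.mul_apply, AlgEquiv.aut_inv, AlgEquiv.symm_apply_eq] at h1
  exact h1

/-- The restriction of `g ∈ Gal(F̄/F)` to an `F`-algebra map between intermediate fields it relates.
[cite: MochizukiFrdII2008, Ex 1.3 (iii) pp.11-12] -/
noncomputable def restrictBetween (g : GalFbar F) (K₁ K₂ : IntermediateField F (Fbar F))
    (h : ∀ a ∈ K₁, g a ∈ K₂) : K₁ →ₐ[F] K₂ where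
  toFun a := ⟨g a, h a a.2⟩
  map_one' := Subtype.ext (map_one g)
  map_mul' _ _ := Subtype.ext (map_mul g _ _)
  map_zero' := Subtype.ext (map_zero g)
  map_add' _ _ := Subtype.ext (map_add g _ _)
  commutes' r := Subtype.ext (g.commutes r)

/-- Its values. [cite: MochizukiFrdII2008, Ex 1.3 (iii) pp.11-12] -/
@[simp] theorem restrictBetween_apply (g : GalFbar F) (K₁ K₂ : IntermediateField F (Fbar F))
    (h : ∀ a ∈ K₁, g a ∈ K₂) (a : K₁) : (restrictBetween g K₁ K₂ h a : Fbar F) = g a := rfl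

variable (F)

/-- **The field of a connected `G_F`-set**: `F̄^{Stab(x_X)}`, the fixed field of the stabiliser of the base
point ("[cf. Example 1.1, (ii)]", FrdII p. 12: the connected finite étale covering `Spec F̄^{Stab(x)} → Spec F`
corresponding to the transitive `G_F`-set `X ≅ G_F/Stab(x)`). [cite: MochizukiFrdII2008, Ex 1.3 (iii) pp.11-12] -/
noncomputable def fixFld (X : ConnectedPart (BTemp (GalFbar F))) : IntermediateField F (Fbar F) :=
  IntermediateField.fixedField (stabilizerSubgroup X.obj (basePt X))

/-- Membership in the field of `X`: fixed by the stabiliser of the base point.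
[cite: MochizukiFrdII2008, Ex 1.3 (iii) pp.11-12] -/
theorem mem_fixFld_iff (X : ConnectedPart (BTemp (GalFbar F))) (a : Fbar F) :
    a ∈ fixFld F X ↔ ∀ σ : GalFbar F, X.obj.obj.ρ σ (basePt X) = basePt X → σ a = a := by
  rw [fixFld, IntermediateField.mem_fixedField_iff]
  exact forall_congr' fun σ => by rw [mem_stabilizerSubgroup_iff]

/-- **Finiteness** (Krull's Galois correspondence, for `F` perfect so that `F̄/F` is Galois): the
stabiliser is OPEN (`B^temp`: continuous action on a discrete set), hence so is the fixing group of its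
fixed field, hence that fixed field is finite over `F` (Mathlib `InfiniteGalois.isOpen_iff_finite`).
[cite: MochizukiFrdII2008, Ex 1.3 (iii) pp.11-12] -/
theorem finiteDimensional_fixFld [PerfectField F] (X : ConnectedPart (BTemp (GalFbar F))) :
    FiniteDimensional F (fixFld F X) := by
  haveI : IsGalois F (Fbar F) := {}
  rw [← InfiniteGalois.isOpen_iff_finite]
  exact Subgroup.isOpen_mono ((IntermediateField.le_iff_le _ _).mp le_rfl)
    (isOpen_stabilizerSubgroup X.obj (basePt X))

/-- … and separable over `F` (`F` perfect). [cite: MochizukiFrdII2008, Ex 1.3 (iii) pp.11-12] -/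
theorem isSeparable_fixFld [PerfectField F] (X : ConnectedPart (BTemp (GalFbar F))) :
    Algebra.IsSeparable F (fixFld F X) := by
  haveI := finiteDimensional_fixFld F X
  infer_instance

/-- The object `Spec F̄^{Stab(x_X)}` of `D₀ = FinEtale F`. [cite: MochizukiFrdII2008, Ex 1.3 (iii) pp.11-12] -/
noncomputable def fieldObj [PerfectField F] (X : ConnectedPart (BTemp (GalFbar F))) :
    FinEtale F :=
  @FinEtale.mk F _ (fixFld F X) _ _ (finiteDimensional_fixFld F X) (isSeparable_fixFld F X)

variable {F}

/-- For `f : X → Y` and ANY `g` with `g · x_Y = f(x_X)`: `g` maps `F̄^{Stab(x_Y)}` into `F̄^{Stab(x_X)}`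
(since `Stab(x_X) ⊆ Stab(f x_X) = g Stab(x_Y) g⁻¹`). [cite: MochizukiFrdII2008, Ex 1.3 (iii) pp.11-12] -/
theorem apply_mem_fixFld {X Y : ConnectedPart (BTemp (GalFbar F))} (f : X ⟶ Y)
    {g : GalFbar F} (hg : Y.obj.obj.ρ g (basePt Y) = ptMap f (basePt X))
    {a : Fbar F} (ha : a ∈ fixFld F Y) : g a ∈ fixFld F X :=
  apply_mem_fixedField_of_conj_mem (fun _ hσ => conj_mem_stabilizer_of_ρ_eq f hg hσ) ha

/-- **The field map of a `G_F`-map**: `F̄^{Stab(x_Y)} → F̄^{Stab(x_X)}`, `a ↦ g_f · a` — i.e. the morphism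
`Spec F̄^{Stab(x_X)} → Spec F̄^{Stab(x_Y)}` of `D₀` over `f`. [cite: MochizukiFrdII2008, Ex 1.3 (iii) pp.11-12] -/
noncomputable def fieldMap {X Y : ConnectedPart (BTemp (GalFbar F))} (f : X ⟶ Y) :
    fixFld F Y →ₐ[F] fixFld F X :=
  restrictBetween (carrier f) _ _ fun _ ha => apply_mem_fixFld f (carrier_spec f) ha

/-- The field map does not depend on the choice of the carrying element: for ANY `g` with
`g · x_Y = f(x_X)` it is `a ↦ g·a`. [cite: MochizukiFrdII2008, Ex 1.3 (iii) pp.11-12] -/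
theorem fieldMap_apply_of_ρ_eq {X Y : ConnectedPart (BTemp (GalFbar F))} (f : X ⟶ Y)
    {g : GalFbar F} (hg : Y.obj.obj.ρ g (basePt Y) = ptMap f (basePt X))
    (a : fixFld F Y) : (fieldMap f a : Fbar F) = g a := by
  rw [fieldMap, restrictBetween_apply]
  exact (apply_eq_apply_of_inv_mul_mem
    (inv_mul_mem_stabilizer_of_ρ_eq ((carrier_spec f).trans hg.symm)) a.2).symm

/-- Identity: the carrying element of `𝟙 X` stabilises `x_X`, so it fixes `F̄^{Stab(x_X)}` pointwise.
[cite: MochizukiFrdII2008, Ex 1.3 (iii) pp.11-12] -/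
theorem fieldMap_id_apply (X : ConnectedPart (BTemp (GalFbar F))) (a : fixFld F X) :
    (fieldMap (𝟙 X) a : Fbar F) = a := by
  rw [fieldMap_apply_of_ρ_eq (𝟙 X) (g := 1) (by rw [BTempConnected.ρ_one_apply]; rfl)]
  rfl

/-- Composition: `g_f · (g_h · a) = g_{f ≫ h} · a` on `F̄^{Stab(x_Z)}`, because `g_f g_h` carries `x_Z` to
`h(f(x_X))`. [cite: MochizukiFrdII2008, Ex 1.3 (iii) pp.11-12] -/
theorem fieldMap_comp_apply {X Y Z : ConnectedPart (BTemp (GalFbar F))} (f : X ⟶ Y)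
    (h : Y ⟶ Z) (a : fixFld F Z) :
    (fieldMap f (fieldMap h a) : Fbar F) = fieldMap (f ≫ h) a := by
  have hcarry : Z.obj.obj.ρ (carrier f * carrier h) (basePt Z) = ptMap (f ≫ h) (basePt X) := by
    rw [BTempConnected.ρ_mul_apply, carrier_spec h, ← ptMap_ρ, carrier_spec f, ptMap_comp]
  rw [fieldMap_apply_of_ρ_eq (f ≫ h) hcarry, AlgEquiv.mul_apply,
    fieldMap_apply_of_ρ_eq f (carrier_spec f) (fieldMap h a), fieldMap_apply_of_ρ_eq h (carrier_spec h) a]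

variable (F)

/-- **FrdII Example 1.3 (iii) "[cf. Example 1.1, (ii)]" — the Galois-correspondence functor
`B^temp(G_F)⁰ → D₀ = FinEtale F`**: a connected continuous `G_F`-set `X` goes to the connected finite étale
covering `Spec F̄^{Stab(x_X)} → Spec F`, a `G_F`-map `f : X → Y` to the covering map induced by `a ↦ g_f·a`
(`F` perfect). [cite: MochizukiFrdII2008, Ex 1.3 (iii) pp.11-12] -/
noncomputable def galoisFields [PerfectField F] :
    ConnectedPart (BTemp (GalFbar F)) ⥤ FinEtale F where
  obj X := fieldObj F X
  map f := ⟨fieldMap f⟩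
  map_id X := FinEtale.hom_ext (AlgHom.ext fun a => Subtype.ext (fieldMap_id_apply X a))
  map_comp f h := FinEtale.hom_ext (AlgHom.ext fun a => Subtype.ext (fieldMap_comp_apply f h a).symm)

/-- The carrier of `galoisFields F X` is the fixed field `F̄^{Stab(x_X)}`. [cite: MochizukiFrdII2008, Ex 1.3 (iii) pp.11-12] -/
theorem galoisFields_obj_carrier [PerfectField F] (X : ConnectedPart (BTemp (GalFbar F))) :
    ((galoisFields F).obj X).carrier = ↥(fixFld F X) := rfl

/-- The field map of `galoisFields F f` is `a ↦ g · a` for any `g` carrying `x_Y` to `f(x_X)`.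
[cite: MochizukiFrdII2008, Ex 1.3 (iii) pp.11-12] -/
theorem galoisFields_map_alg [PerfectField F] {X Y : ConnectedPart (BTemp (GalFbar F))} (f : X ⟶ Y) :
    ((galoisFields F).map f).alg = fieldMap f := rfl

/-- … namely `a ↦ g · a` for ANY `g` carrying `x_Y` to `f(x_X)`. [cite: MochizukiFrdII2008, Ex 1.3 (iii) pp.11-12] -/
theorem galoisFields_map_apply [PerfectField F] {X Y : ConnectedPart (BTemp (GalFbar F))}
    (f : X ⟶ Y) {g : GalFbar F} (hg : Y.obj.obj.ρ g (basePt Y) = ptMap f (basePt X))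
    (a : fixFld F Y) : ((fieldMap f a : fixFld F X) : Fbar F) = g a :=
  fieldMap_apply_of_ρ_eq f hg a

/-- The stabiliser of a point is CLOSED (it is open), so Krull's correspondence returns it as the fixing
group of its fixed field. [cite: MochizukiFrdII2008, Ex 1.3 (iii) pp.11-12] -/
theorem fixingSubgroup_fixFld [PerfectField F] (X : ConnectedPart (BTemp (GalFbar F))) :
    (fixFld F X).fixingSubgroup = stabilizerSubgroup X.obj (basePt X) := by
  haveI : IsGalois F (Fbar F) := {}
  exact InfiniteGalois.fixingSubgroup_fixedField
    ⟨stabilizerSubgroup X.obj (basePt X), Subgroup.isClosed_of_isOpen _ (isOpen_stabilizerSubgroup _ _)⟩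

/-- **`galoisFields F` is faithful**: two `G_F`-maps `f, f' : X → Y` out of a connected `X` with the same
field map agree — `g_f⁻¹ g_{f'}` fixes `F̄^{Stab(x_Y)}` pointwise, so lies in `Stab(x_Y)`, so
`f(x_X) = g_f·x_Y = g_{f'}·x_Y = f'(x_X)`, and maps out of a single orbit are determined by one value.
[cite: MochizukiFrdII2008, Ex 1.3 (iii) pp.11-12] -/
theorem galoisFields_faithful [PerfectField F] : (galoisFields F).Faithful := by
  refine ⟨fun {X Y} f f' hff' => ?_⟩
  -- `g_f⁻¹ g_{f'}` fixes the field of `Y`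
  have h12 : ∀ a : fixFld F Y, (fieldMap f a : Fbar F) = fieldMap f' a := fun a =>
    congrArg (fun φ : fieldObj F X ⟶ fieldObj F Y => ((show ↥(fixFld F X) from φ.alg a) : Fbar F)) hff'
  have hfix : (carrier f)⁻¹ * carrier f' ∈ (fixFld F Y).fixingSubgroup := by
    rw [IntermediateField.mem_fixingSubgroup_iff]
    intro a ha
    have h1 := fieldMap_apply_of_ρ_eq f (carrier_spec f) ⟨a, ha⟩
    have h2 := fieldMap_apply_of_ρ_eq f' (carrier_spec f') ⟨a, ha⟩
    rw [AlgEquiv.mul_apply, AlgEquiv.aut_inv, AlgEquiv.symm_apply_eq, ← h2, ← h12, h1]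
  have hstab : (carrier f)⁻¹ * carrier f' ∈ stabilizerSubgroup Y.obj (basePt Y) := by
    rw [← fixingSubgroup_fixFld]; exact hfix
  have hstab' : Y.obj.obj.ρ ((carrier f)⁻¹ * carrier f') (basePt Y) = basePt Y :=
    mem_stabilizerSubgroup_iff.mp hstab
  rw [BTempConnected.ρ_mul_apply] at hstab'
  have hpt : ptMap f (basePt X) = ptMap f' (basePt X) := by
    rw [← carrier_spec f, ← carrier_spec f']
    conv_lhs => rw [← hstab', BTempConnected.ρ_apply_inv]
  exact ObjectProperty.hom_ext _ (BTempConnected.hom_eq_of_apply_eq X.property f.hom f'.hom (basePt X) hpt)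

end Galois

end QuasiTemperoid

end Literature.AlgebraicGeometry.Frobenioids
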